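import Literature.NumberTheory.EllipticCurves.SelmerCorankHolds
import Literature.NumberTheory.EllipticCurves.ZpCorankQuasiIso

/-!
# Crux `PAdicOrderPadicBSDrankR2` (stmt-BirchSwinnertonDyer-0490), line `Sketch` — stub Ш:
# `Ш(E/ℚ)[p^∞]` finite ⇒ `corank_{ℤ_p} Sel_{p^∞}(E/ℚ) = rank E(ℚ)`

Registered stub `stub_padicBSDrank_rankEqCorankOfShaFinite` of the skeleton
`Cruxes/PAdicOrderPadicBSDrankR2/Lines/Sketch.lean` (v3), the Ш-leg of the odd-`p` composition
`ord_T L_p(E,T) = corank Sel_{p^∞}(E/ℚ) = rank E(ℚ)`, fed at the point by the route item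
`SelmerRankShaPFinite` (stmt-0132: `Ш(E/ℚ)[p^∞]` finite). Pure bookkeeping from two PROVED tree
theorems:
* the Kummer corank identity `corank_{ℤ_p} Sel_{p^∞}(E/ℚ) = rank E(ℚ) + corank_{ℤ_p} Ш(E/ℚ)[p^∞]`
  (`WeierstrassCurve.selmerCorank_eq_mordellWeilRank_add_holds`, Greenberg LNM 1716 §1), and
* a finite abelian group has `ℤ_p`-corank `0` (`zpCorank_of_finite_eq_zero`), applied to
  `Ш(E/ℚ)[p^∞] = AddCommGroup.primaryComponent Ш p`, whose corank is `WeierstrassCurve.shaCorank`.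
Greenberg, *Iwasawa theory for elliptic curves*, LNM 1716 (1999), §1, p. 53 (corank identity).
-/

-- D-0017: single-problem summit, so `Summit.BirchSwinnertonDyer.BirchSwinnertonDyer.…` repeats a
-- namespace BY DESIGN.
set_option linter.dupNamespace false

namespace Summit.BirchSwinnertonDyer.BirchSwinnertonDyer.Theorems

open Literature.NumberTheory.EllipticCurves

/-- **Stub Ш of line `Sketch` (crux #3 `PAdicOrderPadicBSDrankR2`): `Ш(E/ℚ)[p^∞]` finite ⇒
`corank_{ℤ_p} Sel_{p^∞}(E/ℚ) = rank E(ℚ)`**, from the PROVED corank identity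
`corank Sel_{p^∞} = rank + corank Ш[p^∞]` (`WeierstrassCurve.selmerCorank_eq_mordellWeilRank_add_holds`)
and `corank` of a finite group `= 0` (`zpCorank_of_finite_eq_zero`, applied to
`Ш[p^∞] = AddCommGroup.primaryComponent Ш p`, i.e. `W.shaCorank p = 0`).
[cite: GreenbergLNM1716, §1 (p. 53, corank identity)] -/
theorem stub_padicBSDrank_rankEqCorankOfShaFinite :
    ∀ (W : WeierstrassCurve ℚ) [W.IsElliptic] (p : ℕ) [Fact p.Prime],
      Finite (AddCommGroup.primaryComponent W.sha p) → W.selmerCorank p = W.mordellWeilRank := by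
  intro W _ p _ hfin
  have h0 : W.shaCorank p = 0 := by
    unfold WeierstrassCurve.shaCorank
    exact zpCorank_of_finite_eq_zero p
  have h1 : W.selmerCorank p = W.mordellWeilRank + W.shaCorank p :=
    W.selmerCorank_eq_mordellWeilRank_add_holds p
  omega

end Summit.BirchSwinnertonDyer.BirchSwinnertonDyer.Theorems
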